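import Summits.CriticalPhenomena.SAWScalingLimit.Theses.SAWRestrictionRigidity
import Literature.Probability.RandomPlanarGeometry.LatticeSimilarityCovariance
import Literature.Probability.RandomPlanarGeometry.ConformalRestrictionProofs
import HarnessLib

/-!
# Mark-fixing disc covariance implies direction-preserving disc covariance

Stub `stub_dpDiscOfMarkFixing` (B1½, bookkeeping) of line `registered` (skeleton v6, the
"mark-fixing cut") for the crux `Rigidity` (stmt-CriticalPhenomena-1368, route
SAWRestrictionRigidity).

Let `P : DobrushinDomain → Measure (CurveClass ℂ)` be a chordal curve family which is covariant
under the lattice similarities (`ChordalFamily.IsLatticeSimilarityCovariant`; only the real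
dilations + translations `z ↦ r z + w`, `r > 0`, i.e. the `k = 0` part of the similarity clause,
are used). Suppose the laws of two-marked unit discs `(𝔻; p, q)` transport,
`P (Φ 𝔻; p, q) = Φ_* P (𝔻; p, q)`, along every `Φ : C(ℂ, ℂ)` complex differentiable and
injective on an open neighbourhood `U` of the closed disc which FIXES both marks. Then they
transport along every such `Φ` which is merely DIRECTION-PRESERVING on the marks,
`Φ q - Φ p = r (q - p)` with `r > 0`, to the image domain marked at `Φ p, Φ q`.

Proof. Let `S z = r⁻¹ z + (p - r⁻¹ Φ p)` (`similarity r⁻¹ _ _`), the real dilation + translation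
with `S (Φ p) = p`, `S (Φ q) = q`. Then `Φ' = S ∘ Φ` is complex differentiable and injective on `U`
and fixes `p, q`, and the image domain `S D'` has carrier `Φ' '' 𝔻` and marks `p, q`; the
mark-fixing hypothesis gives `P (S D') = Φ'_* P 𝔻 = S_* Φ_* P 𝔻`, lattice-similarity covariance
gives `P (S D') = S_* P D'`, and pushing forward along `S⁻¹` cancels `S_*`
(`Measure.map_map`, functoriality of `CurveClass.map`).

References: G. F. Lawler, O. Schramm, W. Werner, *Conformal restriction: the chordal case* (2003),
§3 (restriction measures on `(ℍ; 0, ∞)` and their dilation invariance); W. Werner, *Lectures on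
two-dimensional critical percolation* (2007), §3.2 (1).
-/

noncomputable section

open Set MeasureTheory
open Literature.Probability.RandomPlanarGeometry

namespace Summit.CriticalPhenomena.SAWScalingLimit.Cruxes.Rigidity.MarkFixing

/-- Push-forward of curve laws along a plane homeomorphism `S` is cancelled by push-forward along
`S⁻¹`: `S⁻¹_* S_* μ = μ` (`Measure.map_map`, functoriality of `CurveClass.map`). [folklore] -/
theorem map_map_curveClassMap_symm (S : ℂ ≃ₜ ℂ) (μ : Measure (CurveClass ℂ)) :
    (μ.map (CurveClass.map (S : C(ℂ, ℂ)))).map (CurveClass.map (S.symm : C(ℂ, ℂ))) = μ := by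
  have hcomp : (S.symm : C(ℂ, ℂ)).comp (S : C(ℂ, ℂ)) = ContinuousMap.id ℂ :=
    ContinuousMap.ext fun z => S.symm_apply_apply z
  have hmaps : CurveClass.map (S.symm : C(ℂ, ℂ)) ∘ CurveClass.map (S : C(ℂ, ℂ)) = id := by
    funext c
    rw [Function.comp_apply, CurveClass.map_map, hcomp, CurveClass.map_id, id]
  rw [Measure.map_map (CurveClass.measurable_map _) (CurveClass.measurable_map _), hmaps,
    Measure.map_id]

/-- **Stub B1½ (`stub_dpDiscOfMarkFixing`): mark-fixing ⇒ direction-preserving at the analytic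
disc.** If the laws of two-marked unit discs transport along every mark-fixing `Φ` complex
differentiable and injective near the closed disc, and the family is covariant under the lattice
similarities (only `z ↦ r z + w`, `r > 0`, is used), then they transport along every such `Φ`
which is direction-preserving on the marks, `Φ q - Φ p = r (q - p)` with `r > 0`: compose `Φ`
with the real dilation + translation `S : Φ p ↦ p, Φ q ↦ q`, apply the hypothesis to the
mark-fixing map `S ∘ Φ` and the domain `S D'`, undo `S` on the domain side by lattice-similarity
covariance and on the measure side by pushing forward along `S⁻¹`. [folklore] -/
theorem stub_dpDiscOfMarkFixing : ∀ P : Literature.Probability.RandomPlanarGeometry.ChordalFamily, P.IsLatticeSimilarityCovariant → (∀ (D₀ D' : Literature.Probability.RandomPlanarGeometry.DobrushinDomain) (Φ : C(ℂ, ℂ)) (U : Set ℂ), D₀.carrier = Metric.ball 0 1 → IsOpen U → closure D₀.carrier ⊆ U → DifferentiableOn ℂ Φ U → Set.InjOn Φ U → Φ (D₀.pt 0) = D₀.pt 0 → Φ (D₀.pt 1) = D₀.pt 1 → D'.carrier = Φ '' D₀.carrier → D'.pt 0 = D₀.pt 0 → D'.pt 1 = D₀.pt 1 → P D' = (P D₀).map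 (Literature.Probability.RandomPlanarGeometry.CurveClass.map Φ)) → ∀ (D₀ D' : Literature.Probability.RandomPlanarGeometry.DobrushinDomain) (Φ : C(ℂ, ℂ)) (U : Set ℂ), D₀.carrier = Metric.ball 0 1 → IsOpen U → closure D₀.carrier ⊆ U → DifferentiableOn ℂ Φ U → Set.InjOn Φ U → (∃ r : ℝ, 0 < r ∧ Φ (D₀.pt 1) - Φ (D₀.pt 0) = (r : ℂ) * (D₀.pt 1 - D₀.pt 0)) → D'.carrier = Φ '' D₀.carrier → D'.pt 0 = Φ (D₀.pt 0) → D'.pt 1 = Φ (D₀.pt 1) → P D' = (P D₀).map (Literature.Probability.RandomPlanarGeometry.CurveClass.map Φ) := by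
  intro P hLS hMF D₀ D' Φ U hD₀ hU hcl hΦd hΦi hdir hD'c hD'0 hD'1
  obtain ⟨r, hr, hdir⟩ := hdir
  -- the re-pinning similarity `S z = r⁻¹ z + (p - r⁻¹ Φ p)`, `S (Φ p) = p`, `S (Φ q) = q`
  have hc : ((r⁻¹ : ℝ) : ℂ) ≠ 0 := Complex.ofReal_ne_zero.2 (inv_pos.2 hr).ne'
  obtain ⟨S, hS⟩ : ∃ S : ℂ ≃ₜ ℂ,
      S = similarity ((r⁻¹ : ℝ) : ℂ) hc (D₀.pt 0 - ((r⁻¹ : ℝ) : ℂ) * Φ (D₀.pt 0)) := ⟨_, rfl⟩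
  have hSapp : ∀ z : ℂ, S z = ((r⁻¹ : ℝ) : ℂ) * z + (D₀.pt 0 - ((r⁻¹ : ℝ) : ℂ) * Φ (D₀.pt 0)) := by
    intro z
    rw [hS, similarity_apply]
  have hS0 : S (Φ (D₀.pt 0)) = D₀.pt 0 := by
    rw [hSapp]
    ring
  have hS1 : S (Φ (D₀.pt 1)) = D₀.pt 1 := by
    have hr0 : (r : ℂ) ≠ 0 := Complex.ofReal_ne_zero.2 hr.ne'
    rw [hSapp, Complex.ofReal_inv]
    calc (r : ℂ)⁻¹ * Φ (D₀.pt 1) + (D₀.pt 0 - (r : ℂ)⁻¹ * Φ (D₀.pt 0))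
        = (r : ℂ)⁻¹ * (Φ (D₀.pt 1) - Φ (D₀.pt 0)) + D₀.pt 0 := by ring
      _ = (r : ℂ)⁻¹ * ((r : ℂ) * (D₀.pt 1 - D₀.pt 0)) + D₀.pt 0 := by rw [hdir]
      _ = D₀.pt 1 := by rw [← mul_assoc, inv_mul_cancel₀ hr0, one_mul, sub_add_cancel]
  -- lattice-similarity covariance (`k = 0`): `P (S D') = S_* P D'`
  have hsim : P (D'.map S) = (P D').map (CurveClass.map (S : C(ℂ, ℂ))) := by
    rw [hS]
    exact hLS.1 D' _ hc _ ⟨r⁻¹, 0, inv_pos.2 hr, by simp⟩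
  -- the mark-fixing map `Φ' = S ∘ Φ`
  obtain ⟨Φ', hΦ'⟩ : ∃ Φ' : C(ℂ, ℂ), Φ' = (S : C(ℂ, ℂ)).comp Φ := ⟨_, rfl⟩
  have hΦ'app : ∀ z : ℂ, Φ' z = S (Φ z) := fun z => by rw [hΦ']; rfl
  have hΦ'fun : (Φ' : ℂ → ℂ) =
      fun z => ((r⁻¹ : ℝ) : ℂ) * Φ z + (D₀.pt 0 - ((r⁻¹ : ℝ) : ℂ) * Φ (D₀.pt 0)) :=
    funext fun z => by rw [hΦ'app, hSapp]
  have hΦ'd : DifferentiableOn ℂ Φ' U := by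
    rw [hΦ'fun]
    exact (hΦd.const_mul _).add_const _
  have hΦ'i : Set.InjOn Φ' U := by
    intro x hx y hy hxy
    rw [hΦ'app, hΦ'app] at hxy
    exact hΦi hx hy (S.injective hxy)
  have hΦ'0 : Φ' (D₀.pt 0) = D₀.pt 0 := by rw [hΦ'app, hS0]
  have hΦ'1 : Φ' (D₀.pt 1) = D₀.pt 1 := by rw [hΦ'app, hS1]
  -- the domain `S D'` has carrier `Φ' '' 𝔻` and marks `p, q`
  have hcar : (D'.map S).carrier = Φ' '' D₀.carrier := by
    rw [MarkedDomain.carrier_map, hD'c, Set.image_image]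
    exact Set.image_congr fun z _ => (hΦ'app z).symm
  have hp0 : (D'.map S).pt 0 = D₀.pt 0 := by rw [MarkedDomain.pt_map, hD'0, hS0]
  have hp1 : (D'.map S).pt 1 = D₀.pt 1 := by rw [MarkedDomain.pt_map, hD'1, hS1]
  -- mark-fixing covariance: `P (S D') = Φ'_* P 𝔻`
  have key : P (D'.map S) = (P D₀).map (CurveClass.map Φ') :=
    hMF D₀ (D'.map S) Φ' U hD₀ hU hcl hΦ'd hΦ'i hΦ'0 hΦ'1 hcar hp0 hp1
  -- cancel `S_*` by pushing forward along `S⁻¹`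
  have hcomp : (S.symm : C(ℂ, ℂ)).comp Φ' = Φ :=
    ContinuousMap.ext fun z => by
      change S.symm (Φ' z) = Φ z
      rw [hΦ'app, S.symm_apply_apply]
  have hmaps : CurveClass.map (S.symm : C(ℂ, ℂ)) ∘ CurveClass.map Φ' = CurveClass.map Φ := by
    funext c
    rw [Function.comp_apply, CurveClass.map_map, hcomp]
  have h := congrArg (fun μ : Measure (CurveClass ℂ) => μ.map (CurveClass.map (S.symm : C(ℂ, ℂ))))
    (hsim.symm.trans key)
  rwa [map_map_curveClassMap_symm,
    Measure.map_map (CurveClass.measurable_map _) (CurveClass.measurable_map _), hmaps] at h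

end Summit.CriticalPhenomena.SAWScalingLimit.Cruxes.Rigidity.MarkFixing

end
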